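import Summits.QuantumFields.BalabanUV.T4Continuum.Support.NE7EtaBackgroundCloseness
import Summits.QuantumFields.BalabanUV.T4Continuum.Support.NE7EtaLiaisonAdapter
import Literature.MathematicalPhysics.QuantumFieldTheory.Balaban1983to89.T4TowerRateDischarge

/-!
# NE7EtaBackgroundTowerRate — route #1 of the NE7 crux, stub S7 (NODE O, the BACKGROUND COORDINATE): THE DOCKING — node U3's rate
# ALONG THE TOWER (`URateUpTo K`, K-uniform constant) ON THE BACKGROUND-COORDINATE CARRIER, from `hclose_of_covRoot` through
# `T4TowerRateDischarge.uRateUpTo_of_nodes` BY NAME (the cumulative-gauge readings of `NE7EtaLiaisonAdapter` inhabit its liaison pair)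

Cell `pub-balaban`, rung (B)+1 sub-cell t4, lineage `b2b-balaban-t4-ne7-p1`, generation 25 (CRUX PROVER NE7 #1, ruling e34b3e0c); crux
skeleton `t4/skeletons/NE7-CRUX-R1.md` v1.7.5 §3sexies; sequel of `NE7EtaBackgroundCarrier` (p258129), `NE7EtaBackgroundCloseness` (p258604),
`NE7EtaBackgroundEmbedding` (p258819).  HONEST FRAMING (page 1): FIXED FINITE T⁴, rung (B)+1; NE7, NE3, NE5, NE9 NOT PRINTED in
[Balaban1984PropagatorsI]–[Balaban1989LargeFieldII] and NOT PROVED here; continuum YM on T⁴ ⇐ BetaPertH ∧ nine spine estimates (0/9 proved);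
BetaPertH ⇐ (D1) ∧ (D4) ∧ CAP+tail; G-an2-4 gates asym, D1 and NE2/3/4; NOT infinite volume, NOT mass gap, NOT Clay.

WHAT ([folklore] composition; 0 def).
 * §1 `uRateUpTo_of_hclose` (ANY carrier): route 1's composition of record reads stub S2 through `uRateUpTo_of_nodes`, whose binders are a
   family of readings `R` with `LocalRate R C₃ θ₃` and the liaison `GaugeDominated R uA uB`; `NE7EtaLiaisonAdapter` (p-gen 21) showed that
   the CUMULATIVE-GAUGE readings inhabit both from the plain closeness `hclose : ∀ K, ∀ v ∈ dom, gauge (uA K v) (transport (uB K v)) ≤ C₃θ₃^K`.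
   This theorem packages the two: the hypotheses of `uRateUpTo_of_nodes` with (`hloc`, `hgd`) REPLACED by `hclose`; conclusion verbatim
   (`∃ a ≥ 0, ∀ K, URateUpTo K EA EB (g K) (g (K+1) (·+1)) (uA K) (uB K) dom (a + C₉(γ³Cd)·θ'∕(θ' − max(ω,θc)) + C₅) θ' κ`).
 * §2 **`uRateUpTo_bgCarriers_of_covRoot`** — THE DOCKING ON `NE7EtaBackgroundCarrier.bgCarriers`: the hypotheses of
   `NE7EtaBackgroundCloseness.hclose_of_covRoot` (NE3's covariant root amendment 4 VERBATIM; `hexA`; `hexB` displayed with `hsector` — LOCAL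
   printed-TYPE [Balaban1985Variational] Thm 1 (9) p. 279 + UNPRINTED torus globalisation, `σ_B = σ_B(N)`, asserted nowhere; `hdom`; K-free
   `LevelSmall`; class binders) + node U3's shapes ON THIS CARRIER (`NE9`, `FadingMemory`, `LipBackground` + `PolyLipGrowth`, `NE5`) + node U2's
   `InjectedRate` for the tower table on the printed box + a common rate `θ' ≥ θ = L^{−1∕6}`, `θ' > max(ω, θc)`, `θ' ≥ θ₅` ⟹ selections
   `uA uB` (gauge copies of a minimiser pair FOR THE DATUM ITSELF from the v-free threshold `K₀` on; the trivial background below — finite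
   prefix) and ONE `a ≥ 0` with `URateUpTo K …` FOR EVERY CUTOFF `K` on `dom`.  So the kernel confirms that p258604's conclusion IS the
   `hclose`∕`δc` input of the tower composition, with `θ₃ = θ`, `C₃` from `exists_geometric_majorant`.
HONEST.  Composition BY NAME; every analytic input (NE3's root, hexA, hexB, NE9, the Lipschitz bracket, NE5, node U2's rate) is a
HYPOTHESIS; the functionals `EA`, `EB` on the carrier are ABSTRACT (NODE O's functional half, ownerless — T.2's `ι`∕`hgauge` are inhabited
by p258819, its other eight data are not); nothing printed is asserted; nothing of NE3∕NE5∕NE9∕NE7 discharged; 0 def; 0 sorry.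
-/

set_option autoImplicit false

open scoped BigOperators Matrix Matrix.Norms.L2Operator
open Finset NormedSpace

namespace Summit.QuantumFields.BalabanUV.T4Continuum.NE7EtaBackgroundTowerRate

open Literature.MathematicalPhysics.QuantumFieldTheory.Balaban1983to89
open B7Prop1Explicit B7Prop2Explicit
open T4AveragingDeficitWall hiding Site Plane Plaq Bond
open T4AveragingDeficitWallBoundary (periodBox IsPeriodicCfg)
open T4OutputRate (Carriers Functional NE9 NE5 LipBackground FadingMemory)
open T4TowerRateComposition (PolyLipGrowth URateUpTo)
open T4CauchySum (InjectedRate)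
open T4TowerRateDischarge (uRateUpTo_of_nodes)
open AveragingDeficitPeriodicCounting (IsPeriodicDir)
open AveragingDeficitMultiLevelPrep (LevelSmall)
open MinimalActionSandwich (IsMinimiser)
open MinimalActionRate (Regular sfClass)
open NE3EnergyShapes (residualScale IsUnitarySite IsPeriodicSite)
open NE3EnergyWeightedShapes (energyNormW)
open AveragingDeficitDualResidual (dualC1 dualC2)
open AveragingDeficitDerivWallProof (wallConst)
open NE7EtaBackgroundCarrier NE7EtaLiaisonAdapter

noncomputable section

/-! ## §1 Any carrier: node U3 along the tower from the closeness binder `hclose` (no readings detour left to the user) -/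

section AnyCarrier

variable {Car : Carriers} {ι : Type}

/-- **NODE U3 ALONG THE TOWER FROM `hclose`** (any carrier): `T4TowerRateDischarge.uRateUpTo_of_nodes` with its pair of binders
(`LocalRate R C₃ θ₃`, `GaugeDominated R uA uB`) INHABITED by the cumulative-gauge readings of `NE7EtaLiaisonAdapter` from the closeness
`hclose : ∀ K, ∀ v ∈ dom, gauge (uA K v) (transport (uB K v)) ≤ C₃θ₃^K` — so a producer of `hclose` (e.g. `NE7EtaBackgroundCloseness`) docks
BY NAME.  Conclusion verbatim that of `uRateUpTo_of_nodes` on `dom`. [folklore] -/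
theorem uRateUpTo_of_hclose {W : Set (ℕ → ℝ)} {EA : Functional Car Car.BgA} {EB : Functional Car Car.BgB}
    {κ θ₅ C₅ C₉ ω θc Cd γ C₃ θ₃ P θ' : ℝ} {q : ℕ} {Λ : ℕ → ℕ → ℝ} {CU : (ℕ → ℝ) → ℕ → ℝ} {g : ℕ → ℕ → ℝ}
    {uA : ℕ → ι → Car.BgA} {uB : ℕ → ι → Car.BgB} {dom : Set ι}
    (h9 : NE9 EA W κ Λ) (hΛ : FadingMemory C₉ ω Λ) (hω : 0 ≤ ω)
    (hU : LipBackground EA W κ CU) (hG : PolyLipGrowth CU g P q) (hP : 0 ≤ P)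
    (h5 : NE5 EA EB W κ θ₅ C₅) (hθ₅ : 0 ≤ θ₅) (hC₅ : 0 ≤ C₅)
    (hclose : ∀ K : ℕ, ∀ v ∈ dom, Car.gauge (uA K v) (Car.transport (uB K v)) ≤ C₃ * θ₃ ^ K)
    (hC₃ : 0 ≤ C₃) (hθ₃ : 0 ≤ θ₃) (hθ₃1 : θ₃ < 1)
    (hinj : InjectedRate Cd 0 θc (fun K j => T4CouplingMatching.disc (g K) (g (K + 1)) j)) (hCd : 0 ≤ Cd)
    (hθc : 0 ≤ θc) (hbox : ∀ K i, i ≤ K → 0 < g K i ∧ g K i ≤ γ)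
    (hgA : ∀ K, g K ∈ W) (hgB : ∀ K, (fun i => g (K + 1) (i + 1)) ∈ W)
    (hθ' : max ω θc < θ') (hθ₅' : θ₅ ≤ θ') (hθ₃' : θ₃ ≤ θ') :
    ∃ a : ℝ, 0 ≤ a ∧ ∀ K, URateUpTo K EA EB (g K) (fun i => g (K + 1) (i + 1)) (uA K) (uB K) dom
      (a + C₉ * (γ ^ 3 * Cd) * (θ' / (θ' - max ω θc)) + C₅) θ' κ :=
  uRateUpTo_of_nodes (X := PUnit) h9 hΛ hω hU hG hP h5 hθ₅ hC₅ (localRate_cumGauge dom uA uB hclose) hC₃ hθ₃ hθ₃1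
    (gaugeDominated_cumGauge dom uA uB) hinj hCd hθc hbox hgA hgB hθ' hθ₅' hθ₃'

end AnyCarrier

/-! ## §2 The background-coordinate carrier: node U3 along the tower, modulo NE3's root, hexA∕hexB and node U3's shapes -/

section Background

variable {n : Type} [Fintype n] [DecidableEq n] [Nonempty n]

/-- **ROUTE #1's NODE-U3 RATE ALONG THE TOWER ON THE BACKGROUND-COORDINATE CARRIER** (the docking, by name): the hypotheses of
`NE7EtaBackgroundCloseness.hclose_of_covRoot` (NE3's covariant root amendment 4, `hexA`, `hexB` with `hsector`, `hdom`, K-free `LevelSmall`,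
the carrier's class binders) AND node U3's shapes on the carrier `C = bgCarriers …` — `NE9 EA W κ Λ` with `FadingMemory C₉ ω Λ`,
`LipBackground EA W κ CU` with `PolyLipGrowth CU g P q`, `NE5 EA EB W κ θ₅ C₅` —, node U2's output `InjectedRate Cd 0 θc disc` for the tower
table `g` on the printed box, both runs' sequences in `W`, and ANY common rate `θ'` with `max(ω, θc) < θ'`, `θ₅ ≤ θ'`, `θ = L^{−1∕6} ≤ θ'`.
CONCLUSION: selections `uA uB` (gauge copies of a minimiser pair for the datum itself from `K₀` on, the trivial background below) and ONE
`a ≥ 0` with `URateUpTo K EA EB (g K) (g (K+1) (·+1)) (uA K) (uB K) dom (a + C₉(γ³Cd)θ'∕(θ' − max(ω,θc)) + C₅) θ' κ` FOR EVERY CUTOFF `K`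
(`hclose_of_covRoot` ∘ `uRateUpTo_of_hclose`).  HONEST: every analytic input is a HYPOTHESIS; nothing of NE3∕NE5∕NE9∕NE7 discharged. [folklore] -/
theorem uRateUpTo_bgCarriers_of_covRoot {L N : ℕ} (hL : 2 ≤ L) (hN : 1 ≤ N) {θ : ℝ} (hθ : 0 < θ)
    (hθ6 : θ ^ 6 = ((L : ℝ))⁻¹) {ε : ℝ} (hε : 0 ≤ ε) (hls : ∀ j : ℕ, LevelSmall 4 L j (ε / ((L : ℝ) ^ (j + 1)) ^ 2))
    {b g C Λ₁ Λ₂' : ℝ} (hb : 0 ≤ b) (hbs : 512 * (4 + 1) * (4 + 4) * (L : ℝ) ^ 2 * b ≤ 1) (hg : 0 ≤ g) (hC : 0 ≤ C)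
    (hΛ₂' : 0 < Λ₂') {dom : Set (Site 4 → Fin 4 → (Matrix n n ℂ)ˣ)}
    (hdom : ∀ v ∈ dom, ∀ w : Site 4 → (Matrix n n ℂ)ˣ, IsUnitarySite w → IsPeriodicSite w (N : ℤ) → gaugeAct w v ∈ dom)
    (h : ∀ k : ℕ, 1 ≤ k → ∀ V ∈ dom, ∀ UA UB : Site 4 → Fin 4 → (Matrix n n ℂ)ˣ,
      IsMinimiser 4 (sfClass 4 L N ε) L N k V UA → IsMinimiser 4 (sfClass 4 L N ε) L N (k + 1) V UB →
        Regular 4 L N b g (k + 1) UB →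
        ∃ (u : Site 4 → (Matrix n n ℂ)ˣ) (Z : Site 4 → Fin 4 → Matrix n n ℂ),
          IsUnitarySite u ∧ IsPeriodicSite u ((N * L ^ k : ℕ) : ℤ) ∧
          IsSkewDir Z ∧ IsPeriodicDir Z ((N * L ^ k : ℕ) : ℤ) ∧
          gaugeAct u UA = vary (rescale L (bavg L UB)) Z 1 ∧
          energyNormW L k (rescale L (bavg L UB)) Z (periodBox (N * L ^ k)) ≤ C * residualScale 4 L N b g k ∧
          (∀ (κ : Fin 4) (x : Site 4) (μ : Fin 4),
            ‖Ad (rescale L (bavg L UB) (x + e κ) μ) (Z (x + e μ) κ) - Z x κ‖ ≤ Λ₁ * (((L : ℝ)⁻¹) ^ k) ^ 2) ∧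
          (∀ (κ μ : Fin 4) (y : Site 4),
            ‖Ad (rescale L (bavg L UB) (y + e κ) μ)
                (Ad (rescale L (bavg L UB) (y + e κ + e μ) μ) (Z (y + (2 : ℕ) • e μ) κ) - Z (y + e μ) κ)
              - (Ad (rescale L (bavg L UB) (y + e κ) μ) (Z (y + e μ) κ) - Z y κ)‖ ≤ Λ₂' * (((L : ℝ)⁻¹) ^ k) ^ 3))
    {γ l₁ : ℝ} (hγ : 0 < γ)
    (hγ3 : C * (wallConst 4 L * (N : ℝ) ^ 2 * (Real.sqrt g * dualC2 4 L + 2 * b ^ 2 * dualC1 4 L)) ≤ γ ^ 3)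
    (hl₁ : 0 < l₁) (hΛl₁ : Λ₁ ≤ l₁ ^ 3)
    (hexA : ∀ K : ℕ, 1 ≤ K → ∀ v ∈ dom, ∃ UA : Site 4 → Fin 4 → (Matrix n n ℂ)ˣ, IsMinimiser 4 (sfClass 4 L N ε) L N K v UA)
    {σB c₀ : ℝ} (hσB : 0 ≤ σB) (hsector : (Fintype.card n : ℝ) * (N : ℝ) ^ 2 * ε ≤ c₀)
    (hexB : ∀ K : ℕ, 1 ≤ K → ∀ v ∈ dom, (Fintype.card n : ℝ) * (N : ℝ) ^ 2 * ε ≤ c₀ →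
      ∃ UB : Site 4 → Fin 4 → (Matrix n n ℂ)ˣ, IsMinimiser 4 (sfClass 4 L N ε) L N (K + 1) v UB ∧ Regular 4 L N b g (K + 1) UB ∧
        ∃ uB : Site 4 → (Matrix n n ℂ)ˣ, IsUnitarySite uB ∧ IsPeriodicSite uB ((N * L ^ (K + 1) : ℕ) : ℤ) ∧
          ∃ AB : Site 4 → Fin 4 → Matrix n n ℂ, ∀ (x : Site 4) (κ : Fin 4),
            ((gaugeAct uB UB x κ : (Matrix n n ℂ)ˣ) : Matrix n n ℂ) = exp (AB x κ) ∧ ‖AB x κ‖ ≤ σB * θ ^ (6 * (K + 1)))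
    (D : Type) (sc : D → ℕ) (dl : D → ℝ) (hdl : ∀ X, 0 ≤ dl X) {admA admB : ℕ → Set (Site 4 → Fin 4 → (Matrix n n ℂ)ˣ)}
    (hmaps : ∀ (k : ℕ) (U : Site 4 → Fin 4 → (Matrix n n ℂ)ˣ), U ∈ admB k → rescale L (bavg L U) ∈ admA k)
    (h1A : ∀ k, (1 : Site 4 → Fin 4 → (Matrix n n ℂ)ˣ) ∈ admA k) (h1B : ∀ k, (1 : Site 4 → Fin 4 → (Matrix n n ℂ)ˣ) ∈ admB k)
    (hadmA : ∀ K : ℕ, ∀ V ∈ dom, ∀ U : Site 4 → Fin 4 → (Matrix n n ℂ)ˣ, IsMinimiser 4 (sfClass 4 L N ε) L N K V U → U ∈ admA K)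
    (hadmB : ∀ K : ℕ, ∀ V ∈ dom, ∀ U : Site 4 → Fin 4 → (Matrix n n ℂ)ˣ,
      IsMinimiser 4 (sfClass 4 L N ε) L N (K + 1) V U → U ∈ admB K)
    -- node U3's shapes on the carrier, node U2's output, the window, the common rate
    {W : Set (ℕ → ℝ)} {EA : Functional (bgCarriers n L N D sc dl hdl admA admB hmaps) (bgCarriers n L N D sc dl hdl admA admB hmaps).BgA}
    {EB : Functional (bgCarriers n L N D sc dl hdl admA admB hmaps) (bgCarriers n L N D sc dl hdl admA admB hmaps).BgB}
    {κ θ₅ C₅ C₉ ω θc Cd γg P θ' : ℝ} {q : ℕ} {Λ : ℕ → ℕ → ℝ} {CU : (ℕ → ℝ) → ℕ → ℝ} {gtab : ℕ → ℕ → ℝ}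
    (h9 : NE9 EA W κ Λ) (hΛ : FadingMemory C₉ ω Λ) (hω : 0 ≤ ω)
    (hU : LipBackground EA W κ CU) (hG : PolyLipGrowth CU gtab P q) (hP : 0 ≤ P)
    (h5 : NE5 EA EB W κ θ₅ C₅) (hθ₅ : 0 ≤ θ₅) (hC₅ : 0 ≤ C₅)
    (hinj : InjectedRate Cd 0 θc (fun K j => T4CouplingMatching.disc (gtab K) (gtab (K + 1)) j)) (hCd : 0 ≤ Cd)
    (hθc : 0 ≤ θc) (hbox : ∀ K i, i ≤ K → 0 < gtab K i ∧ gtab K i ≤ γg)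
    (hgA : ∀ K, gtab K ∈ W) (hgB : ∀ K, (fun i => gtab (K + 1) (i + 1)) ∈ W)
    (hθ' : max ω θc < θ') (hθ₅' : θ₅ ≤ θ') (hθθ' : θ ≤ θ') :
    ∃ (uA : ℕ → (Site 4 → Fin 4 → (Matrix n n ℂ)ˣ) → (bgCarriers n L N D sc dl hdl admA admB hmaps).BgA)
      (uB : ℕ → (Site 4 → Fin 4 → (Matrix n n ℂ)ˣ) → (bgCarriers n L N D sc dl hdl admA admB hmaps).BgB) (K₀ : ℕ) (a : ℝ),
      0 ≤ a ∧
      (∀ K : ℕ, K₀ ≤ K → ∀ v ∈ dom, ∃ (UA UB : Site 4 → Fin 4 → (Matrix n n ℂ)ˣ) (wA wB : Site 4 → (Matrix n n ℂ)ˣ),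
        IsMinimiser 4 (sfClass 4 L N ε) L N K v UA ∧ IsMinimiser 4 (sfClass 4 L N ε) L N (K + 1) v UB ∧
        Regular 4 L N b g (K + 1) UB ∧ IsUnitarySite wA ∧ IsPeriodicSite wA ((N * L ^ K : ℕ) : ℤ) ∧
        IsUnitarySite wB ∧ IsPeriodicSite wB ((N * L ^ (K + 1) : ℕ) : ℤ) ∧
        (uA K v).1 = (K, gaugeAct wA UA) ∧ (uB K v).1 = (K, gaugeAct wB UB)) ∧
      (∀ (K : ℕ) (v : Site 4 → Fin 4 → (Matrix n n ℂ)ˣ), ¬ (K₀ ≤ K ∧ v ∈ dom) →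
        (uA K v).1 = (K, 1) ∧ (uB K v).1 = (K, 1)) ∧
      ∀ K : ℕ, URateUpTo K EA EB (gtab K) (fun i => gtab (K + 1) (i + 1)) (uA K) (uB K) dom
        (a + C₉ * (γg ^ 3 * Cd) * (θ' / (θ' - max ω θc)) + C₅) θ' κ := by
  obtain ⟨uA, uB, K₀, C₃, hC₃, hspec, hdef, hclose⟩ := NE7EtaBackgroundCloseness.hclose_of_covRoot hL hN hθ hθ6 hε hls hb hbs hg
    hC hΛ₂' hdom h hγ hγ3 hl₁ hΛl₁ hexA hσB hsector hexB D sc dl hdl hmaps h1A h1B hadmA hadmB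
  obtain ⟨a, ha, hrate⟩ := uRateUpTo_of_hclose h9 hΛ hω hU hG hP h5 hθ₅ hC₅ hclose hC₃ hθ.le (theta_lt_one hL hθ hθ6) hinj hCd
    hθc hbox hgA hgB hθ' hθ₅' hθθ'
  exact ⟨uA, uB, K₀, a, ha, hspec, hdef, hrate⟩

end Background

end

end Summit.QuantumFields.BalabanUV.T4Continuum.NE7EtaBackgroundTowerRate
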